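import Summits.QuantumFields.YangMills.Theorems.UnitScaleTiltFluctuationComparisonRegPrGlobalSlackLocalRowChi
import Summits.QuantumFields.YangMills.Theorems.UnitScaleTiltFluctuationComparisonRegPrGlobalSlackKernelLegRefOwn
import HarnessLib

/-!
# `UnitScaleTiltFluctuationComparisonRegPrGlobalSlackTermRefChi` — THE LOCAL TWO-RUN SLACK ROW OF 3⁗χ AS ONE PER-RUN ROW AGAINST A RUN-COHERENT REFERENCE TERM TABLE, IN RAW
# TERM CURRENCY (crux `FluctuationComparisonRegPrIntL`, stmt-QuantumFields-20520, pen v5kC stub `stub_globalTwoRunSlackFamChi`; width seat ym-ust-20520-w3 g0, OWNER g24 re-point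
# 23:08:53Z «the term-currency reference twin» of ★w1 g0's leg-currency `…GlobalSlackKernelLegRef`/`…RefOwn` (p582696/p583370), endorsed by ★r1 g4 23:08:00Z; YM₃ on the
# 3-torus is ladder rung R3, not the Clay problem)

WHY.  3⁗χ's irreducible content is ONE two-run row in raw term currency — the local slack row `GlobalSlackLocalToGlobal.PolymerCauchyMinAtTSlack` of the canonical term function
`canonPTCore (toCore ∘ p)` at the χ-record's canonical polymerisation (socket of reference `GlobalSlackCanonicalPolymers.K1aLocalSlackRowChi`, p582522; = ★r1 g4's
`K1aPolymerRowChi` at `σ = 7`).  Over the per-`K` `Classical.choice` witnesses of the hypothesis `OfV3ChiAt` (a SEPARATE existential for every `K`) a genuinely cross-`K` row is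
unprovable in principle (finding F-g4-1); ★w1 g0 therefore FACTORS the two cross-run LEG rows through run-independent reference objects ([King1986] Prop. 3.6 read as «each run's
`k`-step objects are within `L^{−γk}` of the `n → ∞` limit», Thm 3.4 uniform in `n`) and reduces them to OWN-indexed per-run rows by pure geometry ((M6) `canonTreeLenCore_refineSet`,
`TreeLenRefinedOn`, `locMatched_canonCore`).  This file does the same ONE LEVEL LOWER, for the term values themselves, so that a v4 per-run (α) record has the option of displaying
ONE row per run (term closeness to a fixed reference table) instead of five:

* §1 `RefTermFam F` (a run-indexed table of reference term values read at the window datum on the comparison lattice), `RefTermCoherent R` (the table is matched along the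
  refinement of point sets — the limit object), the per-run reference row in the form of record `TermRefRowT D PT R b₀ p₀ κ₁ a C` (run `K` at `(1+j, Y)` AND run `K+1` at
  `(2+j, refineSet Y)`, each against ITS OWN entry, indexed like the rows of record), the OWN-indexed row `TermRefOwnRowT` (ONE clause: run `K` on its own lattices, window,
  domains and tree length), **`termRefRowT_of_own`** (`LocMatched D → TreeLenRefinedOn D → TermRefOwnRowT … → TermRefRowT …`, pure geometry) and
  **`polymerCauchyMinAtTSlack_of_termRef`**: `RefTermCoherent R → TermRefRowT D PT R b₀ p₀ κ₁ a C → PolymerCauchyMinAtTSlack D PT b₀ p₀ κ₁ a σ (2C)` (triangle inequality;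
  every slack order `σ`).
* §2 the sockets **`K1aTermRefRowChi`** / **`K1aTermRefOwnRowChi L 𝔠 a₀ a₁ a`** (the reference table quantified BEFORE the (α) hypothesis — it depends on the family, the record
  and the coupling only, never on the (α) witnesses), `k1aTermRefRowChi_of_own` (geometry discharged at the χ-datum: `locMatched_canonCore`, `treeLenRefinedOn_canonCore`),
  **`k1aLocalSlackRowChi_of_termRefRowChi : K1aTermRefRowChi … → K1aLocalSlackRowChi …`** and the capstones **`globalTwoRunSlackFamChi_of_k1aTermRefRowChi`** /
  **`globalTwoRunSlackFamChi_of_k1aTermRefOwnRowChi`** : ⟨THE TEXT OF `stub_globalTwoRunSlackFamChi` VERBATIM⟩ (via p582522).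
CONSEQUENCE FOR THE v4 (α) RECORD (NODE O), term-currency option: 3⁗χ closes over per-`K` choice witnesses as soon as each run's record DISPLAYS the closeness of its canonical
localised term values (43) on its own `θ(n)`-windows to a FIXED coherent reference table (rate `(L^{−(1+j)})^a`, size `e^{−κ𝓛}·θ(n)²·x⁴`) — ONE row per run, no chart family.
HONEST FRAMING.  Hypothesis schemas + one triangle inequality + geometry; the per-run reference row is the UNPRINTED content in another shape (for non-abelian d = 3 neither the
limit table nor the rate is in print; [King1986] (3.56)/(3.58)–(3.61) is the abelian-Higgs mechanism); nothing of [Balaban1985UV3]/[King1986] is asserted; registry untouched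
(`--supports stmt-QuantumFields-20520`); no claim about the crux, d = 4 or the mass gap.

References: C. King, CMP 102 (1986) 649–677 [King1986] (Thm 3.4 (3.9) p.656, (3.42) p.660, Prop. 3.6 (3.56) p.662, (3.58)–(3.61) p.663); T. Bałaban, CMP 102 (1985) 255–275
[Balaban1985UV3] ((24)–(25) p.262, (43)–(44) pp.266–267, (57) p.270); CMP 109 (1987) 249–301 [Balaban1987RG1] ((0.1) p.251).
-/

set_option autoImplicit false

noncomputable section

open scoped BigOperators
open Literature.MathematicalPhysics.QuantumFieldTheory.Balaban1983to89
open Literature.MathematicalPhysics.QuantumFieldTheory.Balaban1983to89.T3ContinuumYM3Torus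
open Literature.MathematicalPhysics.QuantumFieldTheory.Balaban1983to89.T3UnitScaleTilt
open Literature.MathematicalPhysics.QuantumFieldTheory.Balaban1983to89.T3LevelShift
open Literature.MathematicalPhysics.QuantumFieldTheory.Balaban1983to89.T3AlphaInputsAC
open Literature.MathematicalPhysics.QuantumFieldTheory.Balaban1983to89.T3AlphaPolymerSocket
open Literature.MathematicalPhysics.QuantumFieldTheory.Balaban1983to89.T3AlphaInputsACTwoRun
open Literature.MathematicalPhysics.QuantumFieldTheory.Balaban1983to89.T3AlphaInputsACTwoRunLevel
open Literature.MathematicalPhysics.QuantumFieldTheory.Balaban1985CMP102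
open Literature.MathematicalPhysics.QuantumFieldTheory.Balaban1985CMP102.Setting
open Summit.QuantumFields.Balaban3D.Carriers
open Summit.QuantumFields.Balaban3D.Proofs.Primitives
open Summit.QuantumFields.Balaban3D.Proofs.GroupModelLieC (lieC)
open Summit.QuantumFields.YangMills.Theorems
open Summit.QuantumFields.YangMills.Theorems.GlobalSlackLocalToGlobal (PolymerCauchyMinAtTSlack)
open Summit.QuantumFields.YangMills.Theorems.GlobalSlackKernelLeg (TreeLenRefinedOn treeLenRefinedOn_canonCore)

/-! ## §1 Reference term tables, the per-run reference rows, geometry and the triangle inequality (abstract datum) -/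

namespace Summit.QuantumFields.YangMills.Theorems.GlobalSlackTermRef

variable {F : T3Family} {γ : ℝ}

/-- **A REFERENCE TERM TABLE** (run-indexed, like ★w1 g0's reference kernels / loop functionals): for run `K`, height `n`, term step `j` and a point set `Y` of run `K`'s
finest torus, a real-valued functional of the window datum `V` on the comparison lattice `F.P n` — the rôle of [King1986]'s `n → ∞` limit amplitudes, here for whole
localised terms. [cite: King1986, (3.58)-(3.61) p.663] -/
abbrev RefTermFam (F : T3Family) : Type :=
  (K n j : ℕ) → Set (Site (F.P K) 0) → GaugeField (F.P n) 0 (Matrix.specialUnitaryGroup (Fin 2) ℂ) → ℝ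

/-- **COHERENCE OF THE REFERENCE TABLE ALONG REFINEMENT** (hypothesis schema, never asserted): run `K+1`'s entry at `(n, j+1, refineSet Y)` IS run `K`'s entry at
`(n, j, Y)` — the table is ONE object on the physical scales (`L^{(1+j)−K} = L^{(2+j)−(K+1)}`), read through the site matching of the two runs.
[cite: Balaban1987RG1, (0.1) p.251; King1986, (3.58)-(3.61) p.663] -/
def RefTermCoherent (R : RefTermFam F) : Prop :=
  ∀ (K n j : ℕ) (Y : Set (Site (F.P K) 0)) (V : GaugeField (F.P n) 0 (Matrix.specialUnitaryGroup (Fin 2) ℂ)),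
    R (K + 1) n (j + 1) (refineSet F K Y) V = R K n j Y V

/-- **THE PER-RUN REFERENCE ROW IN RAW TERM CURRENCY, FORM OF RECORD** (hypothesis schema, never asserted): datum-independent constants `e K n j Y` such that for every run `K`,
height `n ≤ K`, term step `j < K − n`, window datum `V` (`PlaqSmall θ(n)`) and polymer `Y` of the datum at lattice level `K − n`, term level `1 + j`:
(run `K`) `|PT_K(K−n, 1+j, Y)(V) − R_K(n, j, Y)(V) − e| ≤ C·e^{−κ₁𝓛_K(1+j, Y)}·L^{−4(K−n−1−j)}·θ(n)²·(L^{−(1+j)})^a`, and (run `K+1`, indexed like the rows of record by run `K`'s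
`(j, Y)`) the same for `PT_{K+1}(K+1−n, 2+j, refineSet Y)(V)` against ITS OWN entry `R_{K+1}(n, j+1, refineSet Y)(V)` — [King1986] Prop. 3.6 read as «the `k`-step amplitudes of
each cut-off are within `L^{−γk}` of the limit», for Bałaban's localised terms (43); UNPRINTED for non-abelian d = 3. [cite: King1986, Prop. 3.6 (3.56) p.662, (3.58)-(3.61) p.663; Balaban1985UV3, (43)-(44) pp.266-267] -/
def TermRefRowT (D : AlphaDataT3 F γ) (PT : TermFn F) (R : RefTermFam F) (b₀ p₀ κ₁ a C : ℝ) : Prop :=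
  ∃ e : (K n j : ℕ) → Set (Site (F.P K) 0) → ℝ,
    ∀ (K n : ℕ) (h : n ≤ K), ∀ j : ℕ, j < K - n →
      ∀ V : GaugeField (F.P n) 0 (Matrix.specialUnitaryGroup (Fin 2) ℂ), PlaqSmall (θBal F.L γ b₀ p₀ n) V →
        ∀ Y ∈ D.Loc K (K - n) (D.triv K (K - n)) (1 + j),
          |PT K (K - n) (1 + j) Y
              (fieldShift (F.sitesPerDir_eq (m := F.m) (K := K) (j := K - n) (m' := F.m) (K' := n) (j' := 0) (by omega)) V) -
            R K n j Y V - e K n j Y| ≤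
            C * Real.exp (-κ₁ * D.treeLen K (1 + j) Y) * (((F.L : ℝ) ^ (K - n - 1 - j))⁻¹) ^ 4 *
              (θBal F.L γ b₀ p₀ n ^ 2 * (((F.L : ℝ) ^ (1 + j))⁻¹) ^ a) ∧
          |PT (K + 1) (K + 1 - n) (1 + (j + 1)) (refineSet F K Y)
              (fieldShift (F.sitesPerDir_eq (m := F.m) (K := K + 1) (j := K + 1 - n) (m' := F.m) (K' := n) (j' := 0) (by omega)) V) -
            R (K + 1) n (j + 1) (refineSet F K Y) V - e (K + 1) n (j + 1) (refineSet F K Y)| ≤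
            C * Real.exp (-κ₁ * D.treeLen K (1 + j) Y) * (((F.L : ℝ) ^ (K - n - 1 - j))⁻¹) ^ 4 *
              (θBal F.L γ b₀ p₀ n ^ 2 * (((F.L : ℝ) ^ (1 + j))⁻¹) ^ a)

/-- **THE OWN-INDEXED PER-RUN REFERENCE ROW IN RAW TERM CURRENCY** (hypothesis schema, never asserted): ONE clause — for EVERY run `K`, on run `K`'s own `θ(n)`-windows, own listed
domains `Y ∈ Loc K (K−n) triv (1+j)` and own tree length, `|PT_K(K−n, 1+j, Y)(V) − R_K(n, j, Y)(V) − e K n j Y| ≤ C·e^{−κ₁𝓛_K(1+j, Y)}·L^{−4(K−n−1−j)}·θ(n)²·(L^{−(1+j)})^a` — the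
shape a per-run (α) record would display. [cite: King1986, Prop. 3.6 (3.56) p.662, (3.58)-(3.61) p.663; Balaban1985UV3, (43)-(44) pp.266-267] -/
def TermRefOwnRowT (D : AlphaDataT3 F γ) (PT : TermFn F) (R : RefTermFam F) (b₀ p₀ κ₁ a C : ℝ) : Prop :=
  ∃ e : (K n j : ℕ) → Set (Site (F.P K) 0) → ℝ,
    ∀ (K n : ℕ) (h : n ≤ K), ∀ j : ℕ, j < K - n →
      ∀ V : GaugeField (F.P n) 0 (Matrix.specialUnitaryGroup (Fin 2) ℂ), PlaqSmall (θBal F.L γ b₀ p₀ n) V →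
        ∀ Y ∈ D.Loc K (K - n) (D.triv K (K - n)) (1 + j),
          |PT K (K - n) (1 + j) Y
              (fieldShift (F.sitesPerDir_eq (m := F.m) (K := K) (j := K - n) (m' := F.m) (K' := n) (j' := 0) (by omega)) V) -
            R K n j Y V - e K n j Y| ≤
            C * Real.exp (-κ₁ * D.treeLen K (1 + j) Y) * (((F.L : ℝ) ^ (K - n - 1 - j))⁻¹) ^ 4 *
              (θBal F.L γ b₀ p₀ n ^ 2 * (((F.L : ℝ) ^ (1 + j))⁻¹) ^ a)

/-- **THE OWN-INDEXED ROW GIVES THE FORM OF RECORD, BY GEOMETRY**: `LocMatched D` (run `K`'s level-`(1+j)` domains at height `n` refine to run `K+1`'s level-`(2+j)` domains at the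
same height), `TreeLenRefinedOn D` (tree length does not decrease under the refinement on the listed domains), `0 ≤ κ₁`, `0 ≤ C`, `0 ≤ a` and the window letters
(`1 ≤ L`, `0 < γ ≤ 1`, `0 < b₀`, for `θ ≥ 0`): run `K+1`'s clause at `(2+j, refineSet Y)` is its OWN clause there, with `𝓛_{K+1} ≥ 𝓛_K`, the same level factor
(`K+1−n−1−(j+1) = K−n−1−j`) and `(L^{−(2+j)})^a ≤ (L^{−(1+j)})^a`. [cite: King1986, Prop. 3.6 (3.56) p.662; Balaban1985UV3, (24)-(25) p.262] -/
theorem termRefRowT_of_own {D : AlphaDataT3 F γ} {PT : TermFn F} {R : RefTermFam F} {b₀ p₀ κ₁ a C : ℝ}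
    (hLoc : LocMatched D) (hT : TreeLenRefinedOn D) (hκ : 0 ≤ κ₁) (hC : 0 ≤ C) (ha : 0 ≤ a)
    (hL : 1 ≤ F.L) (hγ : 0 < γ) (hγ1 : γ ≤ 1) (hb : 0 < b₀)
    (h : TermRefOwnRowT D PT R b₀ p₀ κ₁ a C) : TermRefRowT D PT R b₀ p₀ κ₁ a C := by
  obtain ⟨e, he⟩ := h
  refine ⟨e, fun K n hnK j hj V hV Y hY => ⟨he K n hnK j hj V hV Y hY, ?_⟩⟩
  -- run `K+1`'s own clause at height `n`, step `j + 1`, domain `refineSet Y`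
  have hY' : refineSet F K Y ∈ D.Loc (K + 1) (K + 1 - n) (D.triv (K + 1) (K + 1 - n)) (1 + (j + 1)) := by
    have hmaps := (hLoc K n hnK (1 + j) (by omega) (by omega)).mapsTo (Finset.mem_coe.mpr hY)
    rw [show 1 + (j + 1) = 1 + j + 1 by ring]
    exact Finset.mem_coe.mp hmaps
  have hown := he (K + 1) n (by omega) (j + 1) (by omega) V hV (refineSet F K Y) hY'
  rw [show K + 1 - n - 1 - (j + 1) = K - n - 1 - j by omega] at hown
  refine hown.trans ?_
  have hθ : 0 ≤ θBal F.L γ b₀ p₀ n := (T3MinimiserStabilityReduction.θBal_pos hL hγ hγ1 hb p₀ n).le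
  have hLr : (1 : ℝ) ≤ F.L := by exact_mod_cast hL
  have hexp : Real.exp (-κ₁ * D.treeLen (K + 1) (1 + (j + 1)) (refineSet F K Y)) ≤ Real.exp (-κ₁ * D.treeLen K (1 + j) Y) :=
    Real.exp_le_exp.mpr (by nlinarith [hT K (K - n) j Y hY])
  have hrate : (((F.L : ℝ) ^ (1 + (j + 1)))⁻¹) ^ a ≤ (((F.L : ℝ) ^ (1 + j))⁻¹) ^ a :=
    Real.rpow_le_rpow (by positivity) (inv_anti₀ (by positivity) (pow_le_pow_right₀ hLr (by omega))) ha
  have hx : 0 ≤ (((F.L : ℝ) ^ (K - n - 1 - j))⁻¹) ^ 4 := by positivity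
  have hρ' : 0 ≤ (((F.L : ℝ) ^ (1 + (j + 1)))⁻¹) ^ a := Real.rpow_nonneg (by positivity) _
  calc C * Real.exp (-κ₁ * D.treeLen (K + 1) (1 + (j + 1)) (refineSet F K Y)) * (((F.L : ℝ) ^ (K - n - 1 - j))⁻¹) ^ 4 *
        (θBal F.L γ b₀ p₀ n ^ 2 * (((F.L : ℝ) ^ (1 + (j + 1)))⁻¹) ^ a)
      ≤ C * Real.exp (-κ₁ * D.treeLen K (1 + j) Y) * (((F.L : ℝ) ^ (K - n - 1 - j))⁻¹) ^ 4 *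
        (θBal F.L γ b₀ p₀ n ^ 2 * (((F.L : ℝ) ^ (1 + (j + 1)))⁻¹) ^ a) :=
        mul_le_mul_of_nonneg_right (mul_le_mul_of_nonneg_right (mul_le_mul_of_nonneg_left hexp hC) hx) (mul_nonneg (sq_nonneg _) hρ')
    _ ≤ C * Real.exp (-κ₁ * D.treeLen K (1 + j) Y) * (((F.L : ℝ) ^ (K - n - 1 - j))⁻¹) ^ 4 *
        (θBal F.L γ b₀ p₀ n ^ 2 * (((F.L : ℝ) ^ (1 + j))⁻¹) ^ a) :=
        mul_le_mul_of_nonneg_left (mul_le_mul_of_nonneg_left hrate (sq_nonneg _)) (by positivity)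

/-- **THE LOCAL TWO-RUN SLACK ROW FROM THE PER-RUN REFERENCE ROW** (triangle inequality): a coherent reference table and the per-run row with constant `C ≥ 0` give
`PolymerCauchyMinAtTSlack D PT b₀ p₀ κ₁ a σ (2C)` for EVERY slack order `σ` (the slack term `θ(n)^σ ≥ 0` is not used), with the datum-independent shifts
`c K n j Y := e (K+1) n (j+1) (refineSet Y) − e K n j Y`. [cite: King1986, Thm 3.4 (3.9) p.656, (3.42) p.660, Prop. 3.6 (3.56) p.662] -/
theorem polymerCauchyMinAtTSlack_of_termRef {D : AlphaDataT3 F γ} {PT : TermFn F} {R : RefTermFam F} {b₀ p₀ κ₁ a C : ℝ} (σ : ℕ)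
    (hL : 1 ≤ F.L) (hγ : 0 < γ) (hγ1 : γ ≤ 1) (hb : 0 < b₀) (hC : 0 ≤ C)
    (hR : RefTermCoherent R) (h : TermRefRowT D PT R b₀ p₀ κ₁ a C) :
    PolymerCauchyMinAtTSlack D PT b₀ p₀ κ₁ a σ (2 * C) := by
  obtain ⟨e, he⟩ := h
  refine ⟨fun K n j Y => e (K + 1) n (j + 1) (refineSet F K Y) - e K n j Y, fun K n hn j hj V hV Y hY => ?_⟩
  obtain ⟨h₁, h₂⟩ := he K n hn j hj V hV Y hY
  rw [hR K n j Y V] at h₂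
  have hθ : 0 ≤ θBal F.L γ b₀ p₀ n := (T3MinimiserStabilityReduction.θBal_pos hL hγ hγ1 hb p₀ n).le
  set M : ℝ := C * Real.exp (-κ₁ * D.treeLen K (1 + j) Y) * (((F.L : ℝ) ^ (K - n - 1 - j))⁻¹) ^ 4 with hM
  have hM0 : 0 ≤ M := by positivity
  have hρ : 0 ≤ θBal F.L γ b₀ p₀ n ^ 2 * (((F.L : ℝ) ^ (1 + j))⁻¹) ^ a :=
    mul_nonneg (sq_nonneg _) (Real.rpow_nonneg (by positivity) _)
  have hslack : 0 ≤ M * θBal F.L γ b₀ p₀ n ^ σ := mul_nonneg hM0 (pow_nonneg hθ σ)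
  -- triangle inequality: (x' − R − e') − (x − R − e) = x' − x − (e' − e)
  have htri := abs_sub (PT (K + 1) (K + 1 - n) (1 + (j + 1)) (refineSet F K Y)
      (fieldShift (F.sitesPerDir_eq (m := F.m) (K := K + 1) (j := K + 1 - n) (m' := F.m) (K' := n) (j' := 0) (by omega)) V) -
      R K n j Y V - e (K + 1) n (j + 1) (refineSet F K Y))
    (PT K (K - n) (1 + j) Y (fieldShift (F.sitesPerDir_eq (m := F.m) (K := K) (j := K - n) (m' := F.m) (K' := n) (j' := 0) (by omega)) V) -
      R K n j Y V - e K n j Y)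
  calc _ = |(PT (K + 1) (K + 1 - n) (1 + (j + 1)) (refineSet F K Y)
              (fieldShift (F.sitesPerDir_eq (m := F.m) (K := K + 1) (j := K + 1 - n) (m' := F.m) (K' := n) (j' := 0) (by omega)) V) -
              R K n j Y V - e (K + 1) n (j + 1) (refineSet F K Y)) -
            (PT K (K - n) (1 + j) Y (fieldShift (F.sitesPerDir_eq (m := F.m) (K := K) (j := K - n) (m' := F.m) (K' := n) (j' := 0) (by omega)) V) -
              R K n j Y V - e K n j Y)| := by ring_nf
    _ ≤ M * (θBal F.L γ b₀ p₀ n ^ 2 * (((F.L : ℝ) ^ (1 + j))⁻¹) ^ a) + M * (θBal F.L γ b₀ p₀ n ^ 2 * (((F.L : ℝ) ^ (1 + j))⁻¹) ^ a) :=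
        htri.trans (add_le_add h₂ h₁)
    _ ≤ 2 * C * Real.exp (-κ₁ * D.treeLen K (1 + j) Y) * (((F.L : ℝ) ^ (K - n - 1 - j))⁻¹) ^ 4 *
          (θBal F.L γ b₀ p₀ n ^ 2 * (((F.L : ℝ) ^ (1 + j))⁻¹) ^ a + θBal F.L γ b₀ p₀ n ^ σ) := by
        rw [hM] at hslack ⊢
        nlinarith [hslack]

end Summit.QuantumFields.YangMills.Theorems.GlobalSlackTermRef

/-! ## §2 The χ-sockets: the per-run reference row at the χ-record's canonical polymerisation ⟹ the local slack row ⟹ 3⁗χ, by name -/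

namespace Summit.QuantumFields.YangMills.Theorems.GlobalSlackCanonicalPolymers

open Summit.QuantumFields.YangMills.Theorems.GlobalSlackTermRef

/-- **THE PER-RUN REFERENCE ROW (FORM OF RECORD) AT THE χ-RECORD'S CANONICAL POLYMERISATION** (hypothesis schema, never asserted): a constant `C ≥ 0`, a coupling threshold,
and for every family / coupling in the lane's window a COHERENT REFERENCE TERM TABLE `R` — quantified BEFORE the (α) hypothesis, so it depends on the family, the record and the
coupling only, never on the (α) witnesses — such that every inhabited χ-package admits a coherent family `p : ∀ K, PkgAtV3Chi …` with the given [7]-constants whose canonical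
term function obeys the per-run reference row `TermRefRowT` at the χ-datum, decay rate the record's `𝔠.κ`.  No chart family, no letter on the record.
[cite: King1986, Prop. 3.6 (3.56) p.662, (3.58)-(3.61) p.663; Balaban1985UV3, (43)-(44) pp.266-267] -/
def K1aTermRefRowChi (L : ℕ) (𝔠 : AlphaConsts L (suGroupModel 2).N) (a₀ a₁ a : ℝ) : Prop :=
  ∃ (C γB : ℝ), 0 ≤ C ∧ 0 < γB ∧
    ∀ (F : T3Family) (γ : ℝ) (hF : F.L = L) (hγ : 0 < γ), γ ≤ γB → ∀ (hγ1 : γ ≤ (min (hF ▸ 𝔠).gamma0 1) ^ 2),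
      ∃ R : RefTermFam F, RefTermCoherent R ∧
        (AlphaInputsT3AC.OfV3ChiAt F (hF ▸ 𝔠) a₀ a₁ →
          ∃ (p : ∀ K, AlphaInputsT3AC.PkgAtV3Chi F (hF ▸ 𝔠) γ hγ hγ1 K), (∀ K, (p K).a₀ = a₀ ∧ (p K).a₁ = a₁) ∧
            TermRefRowT (AlphaInputsT3AC.dataOfV3chi p (canonPolymerCore fun K => (p K).toCore)) (canonPTCore fun K => (p K).toCore) R
              (hF ▸ 𝔠).b₀ (hF ▸ 𝔠).p₀ (hF ▸ 𝔠).κ a C)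

/-- **THE OWN-INDEXED PER-RUN REFERENCE ROW AT THE χ-RECORD'S CANONICAL POLYMERISATION** (hypothesis schema, never asserted): `K1aTermRefRowChi`'s text with the form-of-record row
`TermRefRowT` REPLACED by the own-indexed row `TermRefOwnRowT` (ONE clause per run) and the rate letter `0 ≤ a` kept implicit in the socket's `0 < a` — the shape a v4 per-run
(α) record would display in term currency. [cite: King1986, Prop. 3.6 (3.56) p.662, (3.58)-(3.61) p.663; Balaban1985UV3, (43)-(44) pp.266-267] -/
def K1aTermRefOwnRowChi (L : ℕ) (𝔠 : AlphaConsts L (suGroupModel 2).N) (a₀ a₁ a : ℝ) : Prop :=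
  ∃ (C γB : ℝ), 0 ≤ C ∧ 0 < γB ∧
    ∀ (F : T3Family) (γ : ℝ) (hF : F.L = L) (hγ : 0 < γ), γ ≤ γB → ∀ (hγ1 : γ ≤ (min (hF ▸ 𝔠).gamma0 1) ^ 2),
      ∃ R : RefTermFam F, RefTermCoherent R ∧
        (AlphaInputsT3AC.OfV3ChiAt F (hF ▸ 𝔠) a₀ a₁ →
          ∃ (p : ∀ K, AlphaInputsT3AC.PkgAtV3Chi F (hF ▸ 𝔠) γ hγ hγ1 K), (∀ K, (p K).a₀ = a₀ ∧ (p K).a₁ = a₁) ∧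
            TermRefOwnRowT (AlphaInputsT3AC.dataOfV3chi p (canonPolymerCore fun K => (p K).toCore)) (canonPTCore fun K => (p K).toCore) R
              (hF ▸ 𝔠).b₀ (hF ▸ 𝔠).p₀ (hF ▸ 𝔠).κ a C)

/-- **THE OWN-INDEXED SOCKET GIVES THE FORM OF RECORD AT THE χ-DATUM** for a nonnegative rate exponent (`termRefRowT_of_own`; geometry discharged: `locMatched_canonCore`,
`GlobalSlackKernelLeg.treeLenRefinedOn_canonCore` (★w1 g0 (M6)); window letters from the record: `0 < 𝔠.κ`, `𝔠.b₀ > 0`, `γ ≤ (min γ₀ 1)² ≤ 1`).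
[cite: King1986, Prop. 3.6 (3.56) p.662; Balaban1985UV3, (24)-(25) p.262; Balaban1987RG1, (0.1) p.251] -/
theorem k1aTermRefRowChi_of_own {L : ℕ} {𝔠 : AlphaConsts L (suGroupModel 2).N} {a₀ a₁ a : ℝ} (ha : 0 ≤ a) (h : K1aTermRefOwnRowChi L 𝔠 a₀ a₁ a) :
    K1aTermRefRowChi L 𝔠 a₀ a₁ a := by
  obtain ⟨C, γB, hC, hγB, hall⟩ := h
  refine ⟨C, γB, hC, hγB, fun F γ hF hγ hγle hγ1 => ?_⟩
  subst hF
  obtain ⟨R, hR, hrow⟩ := hall F γ rfl hγ hγle hγ1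
  refine ⟨R, hR, fun hOf => ?_⟩
  obtain ⟨p, hp, hT⟩ := hrow hOf
  have hγ1' : γ ≤ 1 := hγ1.trans (sq_min_one_le _ 𝔠.gamma0_pos)
  exact ⟨p, hp, termRefRowT_of_own (locMatched_canonCore fun K => (p K).toCore) (treeLenRefinedOn_canonCore fun K => (p K).toCore)
    (kappa_record_admissible 𝔠).1.le hC ha F.hL.2.le hγ hγ1' 𝔠.b₀_pos hT⟩

/-- **THE PER-RUN REFERENCE ROW GIVES THE LOCAL SLACK ROW OF REFERENCE** (`K1aLocalSlackRowChi`, p582522) with `σ := 7` and constant `2C` (`polymerCauchyMinAtTSlack_of_termRef`;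
`1 ≤ L`, `γ ≤ 1`, `0 < b₀` from the family and the record). [cite: King1986, Thm 3.4 (3.9) p.656, Prop. 3.6 (3.56) p.662] -/
theorem k1aLocalSlackRowChi_of_termRefRowChi {L : ℕ} {𝔠 : AlphaConsts L (suGroupModel 2).N} {a₀ a₁ a : ℝ} (h : K1aTermRefRowChi L 𝔠 a₀ a₁ a) :
    K1aLocalSlackRowChi L 𝔠 a₀ a₁ a := by
  obtain ⟨C, γB, hC, hγB, hall⟩ := h
  refine ⟨7, 2 * C, γB, le_rfl, by positivity, hγB, fun F γ hF hγ hγle hγ1 hOf => ?_⟩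
  subst hF
  obtain ⟨R, hR, hrow⟩ := hall F γ rfl hγ hγle hγ1
  obtain ⟨p, hp, hT⟩ := hrow hOf
  have hγ1' : γ ≤ 1 := hγ1.trans (sq_min_one_le _ 𝔠.gamma0_pos)
  exact ⟨p, hp, polymerCauchyMinAtTSlack_of_termRef 7 F.hL.2.le hγ hγ1' 𝔠.b₀_pos hC hR hT⟩

/-- **THE PEN's STUB 3⁗χ `stub_globalTwoRunSlackFamChi` FROM THE PER-RUN REFERENCE ROW IN RAW TERM CURRENCY, BY NAME** (text VERBATIM, OWNER C3 pen `birth_v5kC.lean` :43):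
`k1aLocalSlackRowChi_of_termRefRowChi` then p582522's `globalTwoRunSlackFamChi_of_k1aLocalSlackRowChi`. [cite: King1986, Thm 3.4 (3.9) p.656, (3.42) p.660, Prop. 3.6 (3.56) p.662; Balaban1985UV3, (7) p.257, (43)-(46) pp.266-267, (57) p.270] -/
theorem globalTwoRunSlackFamChi_of_k1aTermRefRowChi
    (h : ∀ (L : ℕ), Odd L → 7 ≤ L → ∀ (𝔠 : AlphaConsts L (suGroupModel 2).N) (a₀ a₁ : ℝ), 0 < a₀ → 0 < a₁ → 𝔠.B₃ * a₁ ≤ a₀ →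
      ∃ a : ℝ, 0 < a ∧ a < 1 ∧ K1aTermRefRowChi L 𝔠 a₀ a₁ a) :
    ∀ (L : ℕ), Odd L → 7 ≤ L → ∀ (𝔠 : Summit.QuantumFields.Balaban3D.Proofs.Primitives.AlphaConsts L (Summit.QuantumFields.Balaban3D.Carriers.suGroupModel 2).N)
      (a₀ a₁ : ℝ), 0 < a₀ → 0 < a₁ → 𝔠.B₃ * a₁ ≤ a₀ →
      ∃ a : ℝ, 0 < a ∧ ∃ γB : ℝ, 0 < γB ∧ ∀ (F : T3Family) (γ : ℝ) (hF : F.L = L) (hγ : 0 < γ), γ ≤ γB →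
        ∀ (hγ1 : γ ≤ (min (hF ▸ 𝔠).gamma0 1) ^ 2),
          Summit.QuantumFields.YangMills.Theorems.AlphaInputsT3AC.OfV3ChiAt F (hF ▸ 𝔠) a₀ a₁ →
          ∃ (p : ∀ K, Summit.QuantumFields.YangMills.Theorems.AlphaInputsT3AC.PkgAtV3Chi F (hF ▸ 𝔠) γ hγ hγ1 K),
            (∀ K, (p K).a₀ = a₀ ∧ (p K).a₁ = a₁) ∧
            ∃ (π : Summit.QuantumFields.YangMills.Theorems.AlphaInputsT3AC.PolymerT3 F) (σ : ℕ) (C : ℝ), 7 ≤ σ ∧ 0 ≤ C ∧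
              Summit.QuantumFields.YangMills.Theorems.GlobalSlack.GlobalSupRateTSlack (Summit.QuantumFields.YangMills.Theorems.AlphaInputsT3AC.dataOfV3chi p π) (hF ▸ 𝔠).b₀ (hF ▸ 𝔠).p₀ a σ C :=
  globalTwoRunSlackFamChi_of_k1aLocalSlackRowChi fun L hLo h7 𝔠 a₀ a₁ ha0 ha1 hw => by
    obtain ⟨a, ha, ha1, hT⟩ := h L hLo h7 𝔠 a₀ a₁ ha0 ha1 hw
    exact ⟨a, ha, ha1, k1aLocalSlackRowChi_of_termRefRowChi hT⟩

/-- **THE PEN's STUB 3⁗χ FROM THE OWN-INDEXED PER-RUN REFERENCE ROW IN RAW TERM CURRENCY, BY NAME** — ONE displayed row per run, no chart family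
(`k1aTermRefRowChi_of_own` with `0 ≤ a` from the socket's `0 < a`, then `globalTwoRunSlackFamChi_of_k1aTermRefRowChi`). [cite: King1986, Thm 3.4 (3.9) p.656, Prop. 3.6 (3.56) p.662, (3.58)-(3.61) p.663; Balaban1985UV3, (43)-(46) pp.266-267] -/
theorem globalTwoRunSlackFamChi_of_k1aTermRefOwnRowChi
    (h : ∀ (L : ℕ), Odd L → 7 ≤ L → ∀ (𝔠 : AlphaConsts L (suGroupModel 2).N) (a₀ a₁ : ℝ), 0 < a₀ → 0 < a₁ → 𝔠.B₃ * a₁ ≤ a₀ →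
      ∃ a : ℝ, 0 < a ∧ a < 1 ∧ K1aTermRefOwnRowChi L 𝔠 a₀ a₁ a) :
    ∀ (L : ℕ), Odd L → 7 ≤ L → ∀ (𝔠 : Summit.QuantumFields.Balaban3D.Proofs.Primitives.AlphaConsts L (Summit.QuantumFields.Balaban3D.Carriers.suGroupModel 2).N)
      (a₀ a₁ : ℝ), 0 < a₀ → 0 < a₁ → 𝔠.B₃ * a₁ ≤ a₀ →
      ∃ a : ℝ, 0 < a ∧ ∃ γB : ℝ, 0 < γB ∧ ∀ (F : T3Family) (γ : ℝ) (hF : F.L = L) (hγ : 0 < γ), γ ≤ γB →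
        ∀ (hγ1 : γ ≤ (min (hF ▸ 𝔠).gamma0 1) ^ 2),
          Summit.QuantumFields.YangMills.Theorems.AlphaInputsT3AC.OfV3ChiAt F (hF ▸ 𝔠) a₀ a₁ →
          ∃ (p : ∀ K, Summit.QuantumFields.YangMills.Theorems.AlphaInputsT3AC.PkgAtV3Chi F (hF ▸ 𝔠) γ hγ hγ1 K),
            (∀ K, (p K).a₀ = a₀ ∧ (p K).a₁ = a₁) ∧
            ∃ (π : Summit.QuantumFields.YangMills.Theorems.AlphaInputsT3AC.PolymerT3 F) (σ : ℕ) (C : ℝ), 7 ≤ σ ∧ 0 ≤ C ∧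
              Summit.QuantumFields.YangMills.Theorems.GlobalSlack.GlobalSupRateTSlack (Summit.QuantumFields.YangMills.Theorems.AlphaInputsT3AC.dataOfV3chi p π) (hF ▸ 𝔠).b₀ (hF ▸ 𝔠).p₀ a σ C :=
  globalTwoRunSlackFamChi_of_k1aTermRefRowChi fun L hLo h7 𝔠 a₀ a₁ ha0 ha1 hw => by
    obtain ⟨a, ha, ha1, hT⟩ := h L hLo h7 𝔠 a₀ a₁ ha0 ha1 hw
    exact ⟨a, ha, ha1, k1aTermRefRowChi_of_own ha.le hT⟩

end Summit.QuantumFields.YangMills.Theorems.GlobalSlackCanonicalPolymers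

end
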